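import Mathlib
import HarnessLib
import Summits.HubbardSuperconductivity.HubbardSuperconductivity.Theorems.KLProgrammeKLRegimeEngineTowerLipschitz
import Summits.HubbardSuperconductivity.HubbardSuperconductivity.Theorems.KLProgrammeKLRegimeEngineTowerDoorToKitPrescribed
import Summits.HubbardSuperconductivity.HubbardSuperconductivity.Theorems.KLProgrammeKLRegimeEngineTowerKitUnits

/-!
# Route `KLProgramme` — crux K3 ENGINE (stmt-HubbardSuperconductivity-20437 `KLRegimeEngineV17F2`), stub (e) proof-input «(e)-D-ROWS»: MERGING THE THREE KIT
# BRACKETS OF THE DEEP DOOR INTO ONE LIPSCHITZ STEP — the `Λ⁻¹`- and `τ`-brackets ride the DIFFERENCE slot, not the source slot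
# (seat hubbard-kl-k3c4-p1 g24, VL lane; pure real analysis; DROWS-SCOPE-g24 v9 §11.2, correction of (B))

The kit image of the deep block-step door (`…TwoVolumeLipDoorKit`, in units `…TwoVolumeLipBornDiffKitUnits`) is a sum of THREE Lipschitz-step brackets
`S₂(bE; μ₁) + Λ⁻¹·S_{2Λ}(bD; μ₂) + t·S₂(bD; μ₂)` (`t = τ/cW`, `μ₂ = bV+bD ≤ μ₁ = bV+bD+bE`), each of the form
`S_{Ct}(ν; μ)(N) = towerFO D σ ν q + Σ_{n∈[2,N]} eΦ^{n−1}ψ^q·towerSLip D τ ν μ n q + Ct·ψ^q e·V(μ)(ΦV(μ))^N/(1−ΦV(μ))`.  The tails depend on the truncation `N`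
and are not law-shaped, so the `Λ⁻¹`/`t` brackets cannot be put in the `N`-independent source slot of `towerBornDiff_le_law_of_profile_tok`; instead, since `towerFO`
and `towerSLip` are LINEAR in the difference slot and `towerSLip`, `towerV`, the tail are MONOTONE in the majorant slot, the three brackets merge into ONE:
**`S₂(bE;μ₁) + Λ⁻¹S_{2Λ}(bD;μ₂) + t·S₂(bD;μ₂) ≤ S_{4+2t}(bE + (Λ⁻¹+t)·bD; μ₁)`** — the Lipschitz step with the difference array `ν := bE + (Λ⁻¹ + t)·bD`
(the deep input difference PLUS the depth-suppressed global one, which the bridge charges to the budget exactly like the re-measurement sources) and `Ct := 4 + 2t`.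

* `towerFO_add`, `towerSLip_add_left`, `towerSLip_const_mul_left`, `towerSLip_mono_right` — linearity / monotonicity of the kit functionals;
* **`lipKitBrackets_le_merged`** — the displayed inequality (`0 < Λ`, `0 ≤ t`, `bD, μ₂ ≥ 0`, `μ₂ ≤ μ₁`, guard `Φ·V(μ₁) < 1`).

Pure real analysis; nothing about the model is asserted; nothing asserts the (D) rows, stub (e), VL, K3 or superconductivity.
References: BGM 2006 §2.8 (2.86)–(2.90), §3 [cite: BenfattoGiulianiMastropietro2006]; Gawȩdzki–Kupiainen 1985 §3.
-/

noncomputable section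

namespace Summit.HubbardSuperconductivity.HubbardSuperconductivity.Theorems.EngineV8

set_option linter.dupNamespace false -- summit = problem name (single-conjunct summit), D-0017

open Real Finset

/-! ## §1 Linearity and monotonicity of the kit functionals -/

/-- `towerFO` is additive in the profile. -/
theorem towerFO_add (D : ℕ) (σ : ℝ) (ν ν' : ℕ → ℝ) (p : ℕ) :
    towerFO D σ (fun m => ν m + ν' m) p = towerFO D σ ν p + towerFO D σ ν' p := by
  unfold towerFO
  rw [← sum_add_distrib]
  exact sum_congr rfl fun m _ => by ring

/-- `towerSLip` is additive in the difference slot. -/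
theorem towerSLip_add_left (D : ℕ) (τ : ℝ) (ν ν' μ : ℕ → ℝ) (n p : ℕ) :
    towerSLip D τ (fun m => ν m + ν' m) μ n p = towerSLip D τ ν μ n p + towerSLip D τ ν' μ n p := by
  unfold towerSLip
  rw [← sum_add_distrib]
  refine sum_congr rfl fun δ _ => ?_
  rw [← sum_add_distrib]
  exact sum_congr rfl fun a _ => by ring

/-- `towerSLip` is homogeneous in the difference slot. -/
theorem towerSLip_const_mul_left (D : ℕ) (τ c : ℝ) (ν μ : ℕ → ℝ) (n p : ℕ) :
    towerSLip D τ (fun m => c * ν m) μ n p = c * towerSLip D τ ν μ n p := by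
  unfold towerSLip
  rw [mul_sum]
  refine sum_congr rfl fun δ _ => ?_
  rw [mul_sum]
  exact sum_congr rfl fun a _ => by ring

/-- `towerSLip` is monotone in the majorant slot (nonnegative data). -/
theorem towerSLip_mono_right {τ : ℝ} (hτ : 0 ≤ τ) {ν μ μ' : ℕ → ℝ} (hν : ∀ m, 0 ≤ ν m) (hμ : ∀ m, 0 ≤ μ m) (hμμ' : ∀ m, μ m ≤ μ' m)
    (D n p : ℕ) : towerSLip D τ ν μ n p ≤ towerSLip D τ ν μ' n p := by
  unfold towerSLip
  refine sum_le_sum fun δ _ => sum_le_sum fun a _ => ?_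
  refine mul_le_mul_of_nonneg_left (prod_le_prod (fun a' _ => by have := hμ (δ a'); positivity)
    fun a' _ => mul_le_mul_of_nonneg_left (hμμ' _) (pow_nonneg hτ _)) ?_
  have := hν (δ a); positivity

/-! ## §2 The merge -/

/-- **THE THREE KIT BRACKETS MERGE INTO ONE LIPSCHITZ STEP.**  For `τ, Φ, ψ ≥ 0`, `0 < Λ`, `0 ≤ t`, profiles `bD, μ₂ ≥ 0` with `μ₂ ≤ μ₁` (any `σ`, `bE`), any `D, N, q`, and
the guard `Φ·towerV D τ μ₁ < 1`:
`S₂(bE;μ₁) + Λ⁻¹·S_{2Λ}(bD;μ₂) + t·S₂(bD;μ₂) ≤ S_{4+2t}(bE + (Λ⁻¹+t)bD; μ₁)` (brackets as in the module docstring). -/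
theorem lipKitBrackets_le_merged {D N q : ℕ} {σ τ Φ ψ Λ t : ℝ} {bE bD μ₁ μ₂ : ℕ → ℝ}
    (hτ : 0 ≤ τ) (hΦ : 0 ≤ Φ) (hψ : 0 ≤ ψ) (hΛ : 0 < Λ) (ht : 0 ≤ t)
    (hbD0 : ∀ m, 0 ≤ bD m) (hμ₂0 : ∀ m, 0 ≤ μ₂ m) (hμ₁₂ : ∀ m, μ₂ m ≤ μ₁ m)
    (hguard : Φ * towerV D τ μ₁ < 1) :
    (towerFO D σ bE q + ∑ n ∈ Icc 2 N, exp 1 * Φ ^ (n - 1) * ψ ^ q * towerSLip D τ bE μ₁ n q +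
        2 * (ψ ^ q * exp 1 * towerV D τ μ₁ * (Φ * towerV D τ μ₁) ^ N / (1 - Φ * towerV D τ μ₁))) +
      Λ⁻¹ * (towerFO D σ bD q + ∑ n ∈ Icc 2 N, exp 1 * Φ ^ (n - 1) * ψ ^ q * towerSLip D τ bD μ₂ n q +
        (2 * Λ) * (ψ ^ q * exp 1 * towerV D τ μ₂ * (Φ * towerV D τ μ₂) ^ N / (1 - Φ * towerV D τ μ₂))) +
      t * (towerFO D σ bD q + ∑ n ∈ Icc 2 N, exp 1 * Φ ^ (n - 1) * ψ ^ q * towerSLip D τ bD μ₂ n q +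
        2 * (ψ ^ q * exp 1 * towerV D τ μ₂ * (Φ * towerV D τ μ₂) ^ N / (1 - Φ * towerV D τ μ₂))) ≤
    towerFO D σ (fun m => bE m + (Λ⁻¹ + t) * bD m) q +
        ∑ n ∈ Icc 2 N, exp 1 * Φ ^ (n - 1) * ψ ^ q * towerSLip D τ (fun m => bE m + (Λ⁻¹ + t) * bD m) μ₁ n q +
      (4 + 2 * t) * (ψ ^ q * exp 1 * towerV D τ μ₁ * (Φ * towerV D τ μ₁) ^ N / (1 - Φ * towerV D τ μ₁)) := by
  have hΛi : 0 ≤ Λ⁻¹ := inv_nonneg.2 hΛ.le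
  have hμ₁0 : ∀ m, 0 ≤ μ₁ m := fun m => (hμ₂0 m).trans (hμ₁₂ m)
  -- names
  set F₁ := towerFO D σ bE q with hF₁
  set F₂ := towerFO D σ bD q with hF₂
  set G₁ := ∑ n ∈ Icc 2 N, exp 1 * Φ ^ (n - 1) * ψ ^ q * towerSLip D τ bE μ₁ n q with hG₁
  set G₂ := ∑ n ∈ Icc 2 N, exp 1 * Φ ^ (n - 1) * ψ ^ q * towerSLip D τ bD μ₂ n q with hG₂
  set G₂' := ∑ n ∈ Icc 2 N, exp 1 * Φ ^ (n - 1) * ψ ^ q * towerSLip D τ bD μ₁ n q with hG₂'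
  set T₁ := ψ ^ q * exp 1 * towerV D τ μ₁ * (Φ * towerV D τ μ₁) ^ N / (1 - Φ * towerV D τ μ₁) with hT₁
  set T₂ := ψ ^ q * exp 1 * towerV D τ μ₂ * (Φ * towerV D τ μ₂) ^ N / (1 - Φ * towerV D τ μ₂) with hT₂
  -- linearity in the difference slot
  have hFO : towerFO D σ (fun m => bE m + (Λ⁻¹ + t) * bD m) q = F₁ + (Λ⁻¹ + t) * F₂ := by
    rw [towerFO_add, hF₁, hF₂]
    congr 1
    exact towerFO_const_mul D σ (Λ⁻¹ + t) bD q
  have hGL : ∑ n ∈ Icc 2 N, exp 1 * Φ ^ (n - 1) * ψ ^ q * towerSLip D τ (fun m => bE m + (Λ⁻¹ + t) * bD m) μ₁ n q = G₁ + (Λ⁻¹ + t) * G₂' := by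
    rw [hG₁, hG₂', mul_sum, ← sum_add_distrib]
    refine sum_congr rfl fun n _ => ?_
    rw [towerSLip_add_left, towerSLip_const_mul_left]
    ring
  -- monotonicity in the majorant slot
  have hG : G₂ ≤ G₂' := by
    rw [hG₂, hG₂']
    exact sum_le_sum fun n _ => mul_le_mul_of_nonneg_left (towerSLip_mono_right hτ hbD0 hμ₂0 hμ₁₂ D n q) (by positivity)
  have hV : towerV D τ μ₂ ≤ towerV D τ μ₁ := towerV_mono hτ le_rfl hμ₂0 hμ₁₂
  have hV0 : 0 ≤ towerV D τ μ₂ := towerV_nonneg hτ hμ₂0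
  have hT : T₂ ≤ T₁ := by
    rw [hT₁, hT₂]
    have h := geomTail_mono hΦ hV0 hV hguard N
    have hψq : 0 ≤ ψ ^ q := pow_nonneg hψ _
    calc ψ ^ q * exp 1 * towerV D τ μ₂ * (Φ * towerV D τ μ₂) ^ N / (1 - Φ * towerV D τ μ₂)
        = ψ ^ q * (exp 1 * towerV D τ μ₂ * (Φ * towerV D τ μ₂) ^ N / (1 - Φ * towerV D τ μ₂)) := by ring
      _ ≤ ψ ^ q * (exp 1 * towerV D τ μ₁ * (Φ * towerV D τ μ₁) ^ N / (1 - Φ * towerV D τ μ₁)) := mul_le_mul_of_nonneg_left h hψq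
      _ = _ := by ring
  have hT0 : 0 ≤ T₂ := by
    rw [hT₂]
    have : 0 < 1 - Φ * towerV D τ μ₂ := by nlinarith [mul_le_mul_of_nonneg_left hV hΦ]
    positivity
  have h1 : Λ⁻¹ * G₂ ≤ Λ⁻¹ * G₂' := mul_le_mul_of_nonneg_left hG hΛi
  have h2 : t * G₂ ≤ t * G₂' := mul_le_mul_of_nonneg_left hG ht
  have h3 : t * T₂ ≤ t * T₁ := mul_le_mul_of_nonneg_left hT ht
  have hΛΛ : Λ⁻¹ * (2 * Λ) = 2 := by field_simp
  rw [hFO, hGL]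
  nlinarith [h1, h2, h3, hT, hT0, hΛΛ]

end Summit.HubbardSuperconductivity.HubbardSuperconductivity.Theorems.EngineV8

end
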